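import Mathlib
import HarnessLib
import Literature.Analysis.SpecialFunctions.LogChooseStirling
import Summits.KontsevichZagierPeriods.Zeta5Search.Denom.TwoTaleP15Forms

/-!
# TwoTaleP15Growth — the coefficient rate `C₁` at P15 is ELEMENTARY: Whipple's partner is a one-signed sum

HONEST FRAMING: systematic search; no irrationality claim unless certified.

fam-measure (pub-zeta5), `families/measure/FAMILY.md` §10.3.  The tree file `Denom/TwoTaleP15Forms` packages
fam-measure's T3 candidate `μ(ζ(2)) ≤ 5.0496` at Zudilin's two-tale point **P15** as the implication
`Inclusion → Decay c → CoeffRate C₁ → … → ExponentLE (zetaValue 2) 5.0496`, with the growth input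
`CoeffRate C₁ : Tendsto (log |formQ n| / n) (𝓝 C₁)` NOT proved (model `C₁ = 42.03361581…`, Zudilin's Lemma 6 via a
saddle point, or Poincaré–Perron on the order-3 / degree-164 recurrence).  This file and its sequel
`TwoTaleP15GrowthLimit` (split only for the 400-line cap; one development) show that NO recurrence and NO saddle point
are needed — THIS PART: the partner sum, the generic Chernoff bounds, the tangent slopes, the critical abscissa `ustar`,
`C₁star` and the upper bound `qhat_le`; THE SEQUEL: the lower bound, the limit, positivity and the packaged implications
(and `TwoTaleP15GrowthEnclosure` then proves `C₁star ≤ 42.0374`):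

* on the two-tale cone the `ζ(2)`-coefficients of the two tales agree up to sign, `q_n = −q̂_n` — this is
  **Whipple's terminating transformation** `₄F₃(1) ↔ ₅F₄(1)` [Bailey 1935, §4.5 (1); Zudilin, arXiv:1310.1526 §6
  eq. (whipple) and Remark 5; Zudilin, arXiv:1611.08806 eq. (11)], a PRINTED classical theorem for general parameters
  (only the companion statement `p_n = −p̂_n`, the "missing brick", is not general).  At P15 it reads
  `formQ n = −qhat n` with the EXPLICIT partner sum `qhat n = Σ_k taleTwoA n k`; we record it as the named input
  `WhippleP15` (not proved in the tree; `formQ 1 = −qhat 1` is checked by `decide`);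
* the partner's summands are ONE-SIGNED BY FORMULA: `taleTwoA n k = C(2k−15n−2, 17n)·C(k−6n−1, 5n)·C(11n, k−13n−1)·
  C(11n, k−15n−1) ≥ 0` (Zudilin's `A_k` of §6 at the Remark-5 partner parameters `â = (32n+2; 11n+1, 13n+1, 15n+1)`,
  `b̂ = (15n+2; 6n+1, 24n+2, 26n+2)`), so `max_k A_k ≤ qhat n ≤ (11n+1)·max_k A_k`;
* **`tendsto_log_qhat_div`** (PROVED, unconditional): `log (qhat n) / n → C₁star`, where `C₁star = rateΛ ustar` is
  the value of the Chernoff tangent plane at a critical abscissa `ustar ∈ [17, 23.9]` with `slopeG ustar = 0`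
  (existence by the intermediate value theorem from `slopeG 17 > 0 > slopeG 23.9`; `slopeG` is the `u`-derivative of
  the max-term entropy, its zero in `(16, 24)` is the relevant root of the quartic
  `(2u−15)²(u−6)(24−u)(26−u) = (2u−32)²(u−11)(u−13)(u−15)`; numerically `ustar = 22.0613586…`,
  `C₁star = 42.03361581…` — uniqueness of the root and the numerical enclosure are NOT part of this file, and are not
  needed for the limit: ANY zero of `slopeG` in the window gives matching upper and lower bounds).  Upper half:
  Chernoff's bound at the exact tangent slopes `tᵢ(ustar)` is AFFINE in `(n, k)` with `k`-coefficient
  `slopeG ustar = 0`, so every summand is `≤ exp(n·C₁star + K₀)`; lower half: the tree's Stirling bound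
  `log_choose_ge_entropy` at `k_n = ⌊ustar·n⌋` plus `KL ≤ χ²` (`chernoff_sub_penalty_le_entropy`), which turns the
  entropy into the same affine form minus a BOUNDED penalty `penP` and `2·log(33n) + 8`;
* **`coeffRate_of_whipple : WhippleP15 → CoeffRate C₁star`** and **`C₁star_pos`** (PROVED; positivity from
  `C(10n,5n) ≤ qhat n`, i.e. `C₁star ≥ 5 log 4`);
* packaged (PROVED implications): `exponentLE_of_whipple : Inclusion → Decay c → WhippleP15 → 31 − S < c →
  ExponentLE (zetaValue 2) (1 + (C₁star + 31 − S)/(c − 31 + S))`; `zetaTwo_exponent_le_of_whipple` (the tree's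
  record implication `… → ExponentLE (zetaValue 2) 5.0496 ∧ Zudilin2014.zetaTwo_irrationalityExponent_le` with
  `CoeffRate`, `0 < C₁` replaced by `WhippleP15` and the enclosure `C₁star ≤ 42.033616`); and the ROBUST variant
  `zetaTwo_exponent_le_of_whipple_robust : Inclusion → Decay 29.1 → WhippleP15 → C₁star ≤ 42.04 →
  ExponentLE (zetaValue 2) 5.0523 ∧ Zudilin2014.zetaTwo_irrationalityExponent_le` (margins `7.9e-3`, `6.4e-3`).

NOTHING here certifies a measure: `Inclusion` (fam-denom, file `Denom/TwoTaleP15Levels`), `Decay` (needs the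
"missing brick" `p_n = −p̂_n` at P15, a.k.a. (bmiss), plus the elementary line-integral bound of FAMILY.md §10.2) and
`WhippleP15` remain named inputs.  What remains for the GROWTH input specifically: (i) `WhippleP15` (in print;
to be formalised — e.g. by a WZ certificate in the terminating length `11n+1` — or replaced by the programme's
certified two-tale identity), (ii) a numerical enclosure of `C₁star` (`≤ 42.04` suffices for the robust
variant: `rateΛ` is concave near `ustar`, `C₁star ≤ rateΛ 22 + (ustar − 22)·slopeG 22`-type bounds over logarithms of
`2, 3, 5, 7, 11, 13, 17, 29, 31` — a digits task for a `LogEnclosures`-style file; not attempted here).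
References: W. N. Bailey, Generalized hypergeometric series (1935) §4.5; W. Zudilin, arXiv:1310.1526 [Zudilin2014ZetaTwo]
§6, Remark 5; W. Zudilin, arXiv:1611.08806 §3 eq. (10)–(11).
-/

noncomputable section

open Filter Topology Finset Real

namespace Summit.KontsevichZagierPeriods.Zeta5Search.TwoTaleP15Growth

open Summit.KontsevichZagierPeriods.Zeta5Search.Denom.TwoTaleP15Forms (formQ formQ_one CoeffRate)
open Literature.Analysis.SpecialFunctions (log_choose_le_entropy log_choose_ge_entropy)

/-! ### The partner sum (tale 2 at the Remark-5 parameters) -/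

/-- Zudilin's `A_k` (arXiv:1310.1526 §6) at the P15 partner: the product of four binomials
`C(2k−15n−2, 17n)·C(k−6n−1, 5n)·C(11n, k−13n−1)·C(11n, k−15n−1)` — a natural number, nonzero exactly for
`16n+1 ≤ k ≤ 24n+1` (inside the summation window `15n+1 ≤ k ≤ 26n+1` no truncated subtraction occurs). -/
def taleTwoA (n k : ℕ) : ℕ :=
  Nat.choose (2 * k - (15 * n + 2)) (17 * n) * Nat.choose (k - (6 * n + 1)) (5 * n) *
    Nat.choose (11 * n) (k - (13 * n + 1)) * Nat.choose (11 * n) (k - (15 * n + 1))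

/-- `qhat n = Σ_{k=15n+1}^{26n+1} A_k = |q̂_n|`, the `ζ(2)`-coefficient of the second tale (up to the global sign
`(−1)^{b̂₂+b̂₃} = +1`). -/
def qhat (n : ℕ) : ℕ := ∑ k ∈ Ico (15 * n + 1) (26 * n + 2), taleTwoA n k

/-- Kernel sanity value: `qhat 1 = 9923952931816770 = −formQ 1` (cf. `TwoTaleP15Forms.formQ_one`). -/
theorem qhat_one : qhat 1 = 9923952931816770 := by
  decide +kernel

/-- Whipple at `n = 1`, in the kernel: `formQ 1 = −qhat 1`. -/
theorem formQ_one_eq_neg_qhat_one : formQ 1 = -((qhat 1 : ℕ) : ℤ) := by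
  rw [formQ_one, qhat_one]; norm_num

/-- **INPUT (PRINTED THEOREM, not yet a tree theorem) — Whipple at P15.**  `q_n = −q̂_n` for all `n ≥ 1`:
the terminating Whipple transformation between the very-well-poised `₅F₄(1)` of the second tale and the Saalschützian
`₄F₃(1)` of the first [Bailey 1935 §4.5 (1)], specialised along Zudilin's Remark 5 (arXiv:1310.1526) to P15.
Verified exactly for `n ≤ 40` (fam-measure/ttrl2) and implied by the program-certified two-tale identity at P15
(fam-tele, `certs/tele/bmiss_P15/`); `n = 1` is `formQ_one_eq_neg_qhat_one`. -/
@[conjecture] def WhippleP15 : Prop :=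
  ∀ n : ℕ, 1 ≤ n → formQ n = -((qhat n : ℕ) : ℤ)

/-! ### Chernoff's bound and its reverse (generic) -/

/-- Chernoff, multiplicative form, for ALL `N K : ℕ` and `0 < t < 1`:
`C(N,K) ≤ exp(K·(−log t) + (N − K)·(−log(1 − t)))` (real subtraction; trivial when `K > N`). -/
theorem choose_le_exp (N K : ℕ) {t : ℝ} (h0 : 0 < t) (h1 : t < 1) :
    (N.choose K : ℝ) ≤ Real.exp (K * (-Real.log t) + ((N : ℝ) - K) * (-Real.log (1 - t))) := by
  by_cases hKN : K ≤ N
  · have hpos : (0 : ℝ) < N.choose K := by exact_mod_cast Nat.choose_pos hKN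
    rw [← Real.exp_log hpos]
    apply Real.exp_le_exp.mpr
    have h := log_choose_le_entropy hKN
    -- entropy ≤ Chernoff at any slope: use the elementary route via `add_pow` instead
    have h1' : 0 < 1 - t := by linarith
    have hsum := add_pow t (1 - t) N
    rw [add_sub_cancel, one_pow] at hsum
    have hterm : (N.choose K : ℝ) * (t ^ K * (1 - t) ^ (N - K)) ≤ 1 := by
      have hle := Finset.single_le_sum (s := range (N + 1)) (a := K)
        (f := fun j => t ^ j * (1 - t) ^ (N - j) * (N.choose j : ℝ))
        (fun j _ => by positivity) (mem_range.mpr (Nat.lt_succ_of_le hKN))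
      rw [← hsum] at hle
      linarith [hle]
    have hp : 0 < t ^ K * (1 - t) ^ (N - K) := by positivity
    have hC : (N.choose K : ℝ) ≤ (t ^ K * (1 - t) ^ (N - K))⁻¹ := by
      rw [← one_div]; exact (le_div_iff₀ hp).mpr hterm
    have hlog := Real.log_le_log hpos hC
    rw [Real.log_inv, Real.log_mul (pow_pos h0 _).ne' (pow_pos h1' _).ne', Real.log_pow, Real.log_pow,
      Nat.cast_sub hKN] at hlog
    linarith
  · rw [not_le] at hKN
    rw [Nat.choose_eq_zero_of_lt hKN]
    simp only [Nat.cast_zero]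
    positivity

/-- `x·(log x − log y) ≤ x·(x/y − 1)` for `x ≥ 0`, `y > 0` (from `log z ≤ z − 1`; both sides vanish at `x = 0`). -/
theorem mul_log_sub_log_le {x y : ℝ} (hx : 0 ≤ x) (hy : 0 < y) :
    x * (Real.log x - Real.log y) ≤ x * (x / y - 1) := by
  rcases eq_or_lt_of_le hx with rfl | hx'
  · simp
  · apply mul_le_mul_of_nonneg_left _ hx
    rw [← Real.log_div hx'.ne' hy.ne']
    exact Real.log_le_sub_one_of_pos (div_pos hx' hy)

/-- **KL ≤ χ²**, binomial form: the entropy form dominates Chernoff's affine form minus the penalty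
`(K − tN)²/(N·t(1−t))`:  `N log N − K log K − (N−K) log(N−K) ≥ K(−log t) + (N−K)(−log(1−t)) − (K − tN)²/(N t(1−t))`
for reals `0 ≤ K ≤ N`, `0 < N`, `0 < t < 1`. -/
theorem chernoff_sub_penalty_le_entropy {N K t : ℝ} (hN : 0 < N) (hK : 0 ≤ K) (hKN : K ≤ N) (h0 : 0 < t)
    (h1 : t < 1) :
    K * (-Real.log t) + (N - K) * (-Real.log (1 - t)) - (K - t * N) ^ 2 / (N * (t * (1 - t))) ≤
      N * Real.log N - K * Real.log K - (N - K) * Real.log (N - K) := by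
  have h1' : 0 < 1 - t := by linarith
  have htN : 0 < t * N := mul_pos h0 hN
  have htN' : 0 < (1 - t) * N := mul_pos h1' hN
  have hA := mul_log_sub_log_le hK htN
  have hB := mul_log_sub_log_le (x := N - K) (by linarith) htN'
  rw [Real.log_mul h0.ne' hN.ne'] at hA
  rw [Real.log_mul h1'.ne' hN.ne'] at hB
  have hpen : K * (K / (t * N) - 1) + (N - K) * ((N - K) / ((1 - t) * N) - 1) =
      (K - t * N) ^ 2 / (N * (t * (1 - t))) := by
    field_simp
    ring
  have hsplit : N * Real.log N = K * Real.log N + (N - K) * Real.log N := by ring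
  nlinarith [hA, hB, hpen, hsplit]

/-- Reverse Chernoff: for `1 ≤ N`, `K ≤ N`, `0 < t < 1`,
`exp(K(−log t) + (N−K)(−log(1−t)) − (K − tN)²/(N t(1−t)) − log N/2 − 2) ≤ C(N,K)`. -/
theorem exp_le_choose {N K : ℕ} (hN : 1 ≤ N) (hKN : K ≤ N) {t : ℝ} (h0 : 0 < t) (h1 : t < 1) :
    Real.exp (K * (-Real.log t) + ((N : ℝ) - K) * (-Real.log (1 - t)) -
        ((K : ℝ) - t * N) ^ 2 / ((N : ℝ) * (t * (1 - t))) - Real.log N / 2 - 2) ≤ (N.choose K : ℝ) := by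
  have hpos : (0 : ℝ) < N.choose K := by exact_mod_cast Nat.choose_pos hKN
  rw [← Real.exp_log hpos]
  apply Real.exp_le_exp.mpr
  have hS := log_choose_ge_entropy hN hKN
  have hE := chernoff_sub_penalty_le_entropy (N := (N : ℝ)) (K := (K : ℝ)) (by exact_mod_cast hN)
    (Nat.cast_nonneg K) (by exact_mod_cast hKN) h0 h1
  linarith

/-! ### The tangent slopes and the affine exponent -/

/-- Slope of the block `C(2k−15n−2, 17n)` at abscissa `u = k/n`: `t₀ = 17/(2u−15)`. -/
def t₀ (u : ℝ) : ℝ := 17 / (2 * u - 15)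
/-- Slope of `C(k−6n−1, 5n)`: `t₁ = 5/(u−6)`. -/
def t₁ (u : ℝ) : ℝ := 5 / (u - 6)
/-- Slope of `C(11n, k−13n−1)`: `t₂ = (u−13)/11`. -/
def t₂ (u : ℝ) : ℝ := (u - 13) / 11
/-- Slope of `C(11n, k−15n−1)`: `t₃ = (u−15)/11`. -/
def t₃ (u : ℝ) : ℝ := (u - 15) / 11

/-- The `n`-coefficient `Λ(u)` of the total Chernoff exponent at slopes `tᵢ(u)`. -/
def rateΛ (u : ℝ) : ℝ :=
  -17 * Real.log (t₀ u) + 32 * Real.log (1 - t₀ u) - 5 * Real.log (t₁ u) + 11 * Real.log (1 - t₁ u) +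
    13 * Real.log (t₂ u) - 24 * Real.log (1 - t₂ u) + 15 * Real.log (t₃ u) - 26 * Real.log (1 - t₃ u)

/-- The `k`-coefficient `G(u)` of the total Chernoff exponent (`= h′(u)`, the derivative of the max-term entropy):
`G(u) = 2 log((2u−15)/(2u−32)) + log((u−6)/(u−11)) + log((24−u)/(u−13)) + log((26−u)/(u−15))`. -/
def slopeG (u : ℝ) : ℝ :=
  -2 * Real.log (1 - t₀ u) - Real.log (1 - t₁ u) - Real.log (t₂ u) + Real.log (1 - t₂ u) - Real.log (t₃ u) +
    Real.log (1 - t₃ u)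

/-- The constant term `K₀(u)` of the total Chernoff exponent (from the `−2, −1, −1, −1` offsets). -/
def constK (u : ℝ) : ℝ :=
  2 * Real.log (1 - t₀ u) + Real.log (1 - t₁ u) + Real.log (t₂ u) - Real.log (1 - t₂ u) + Real.log (t₃ u) -
    Real.log (1 - t₃ u)

/-- The four Chernoff exponents add up to the AFFINE form `n·Λ(u) + k·G(u) + K₀(u)`. -/
theorem affine_eq (u : ℝ) (n k : ℝ) :
    (17 * n * (-Real.log (t₀ u)) + (2 * k - 15 * n - 2 - 17 * n) * (-Real.log (1 - t₀ u))) +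
      (5 * n * (-Real.log (t₁ u)) + (k - 6 * n - 1 - 5 * n) * (-Real.log (1 - t₁ u))) +
      ((k - 13 * n - 1) * (-Real.log (t₂ u)) + (11 * n - (k - 13 * n - 1)) * (-Real.log (1 - t₂ u))) +
      ((k - 15 * n - 1) * (-Real.log (t₃ u)) + (11 * n - (k - 15 * n - 1)) * (-Real.log (1 - t₃ u))) =
    n * rateΛ u + k * slopeG u + constK u := by
  unfold rateΛ slopeG constK; ring

/-- The slopes lie in `(0,1)` for `16 < u < 24`. -/
theorem slopes_mem {u : ℝ} (hu : 16 < u) (hu' : u < 24) :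
    (0 < t₀ u ∧ t₀ u < 1) ∧ (0 < t₁ u ∧ t₁ u < 1) ∧ (0 < t₂ u ∧ t₂ u < 1) ∧ (0 < t₃ u ∧ t₃ u < 1) := by
  unfold t₀ t₁ t₂ t₃
  have h15 : 0 < 2 * u - 15 := by linarith
  have h6 : 0 < u - 6 := by linarith
  have h13 : 0 < u - 13 := by linarith
  have h15' : 0 < u - 15 := by linarith
  refine ⟨⟨by positivity, ?_⟩, ⟨by positivity, ?_⟩, ⟨by positivity, ?_⟩, ⟨by positivity, ?_⟩⟩
  · rw [div_lt_one h15]; linarith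
  · rw [div_lt_one h6]; linarith
  · rw [div_lt_one (by norm_num : (0:ℝ) < 11)]; linarith
  · rw [div_lt_one (by norm_num : (0:ℝ) < 11)]; linarith

/-! ### Upper half: every summand is below the tangent plane -/

/-- Product of four nonnegative bounds. -/
theorem prod4_le {a₁ a₂ a₃ a₄ b₁ b₂ b₃ b₄ : ℝ} (h₁ : 0 ≤ a₁) (h₂ : 0 ≤ a₂) (h₃ : 0 ≤ a₃) (h₄ : 0 ≤ a₄)
    (g₁ : a₁ ≤ b₁) (g₂ : a₂ ≤ b₂) (g₃ : a₃ ≤ b₃) (g₄ : a₄ ≤ b₄) :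
    a₁ * a₂ * a₃ * a₄ ≤ b₁ * b₂ * b₃ * b₄ := by
  have hb₁ : 0 ≤ b₁ := h₁.trans g₁
  have hb₂ : 0 ≤ b₂ := h₂.trans g₂
  have hb₃ : 0 ≤ b₃ := h₃.trans g₃
  gcongr

/-- **Tangent-plane bound**: for `15n+1 ≤ k` and `16 < u < 24`,
`taleTwoA n k ≤ exp(n·Λ(u) + k·G(u) + K₀(u))`. -/
theorem taleTwoA_le_exp (n k : ℕ) (hk : 15 * n + 1 ≤ k) {u : ℝ} (hu : 16 < u) (hu' : u < 24) :
    (taleTwoA n k : ℝ) ≤ Real.exp (n * rateΛ u + k * slopeG u + constK u) := by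
  obtain ⟨⟨a0, b0⟩, ⟨a1, b1⟩, ⟨a2, b2⟩, ⟨a3, b3⟩⟩ := slopes_mem hu hu'
  have e0 : ((2 * k - (15 * n + 2) : ℕ) : ℝ) = 2 * k - 15 * n - 2 := by
    rw [Nat.cast_sub (by omega)]; push_cast; ring
  have e1 : ((k - (6 * n + 1) : ℕ) : ℝ) = k - 6 * n - 1 := by
    rw [Nat.cast_sub (by omega)]; push_cast; ring
  have e2 : ((k - (13 * n + 1) : ℕ) : ℝ) = k - 13 * n - 1 := by
    rw [Nat.cast_sub (by omega)]; push_cast; ring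
  have e3 : ((k - (15 * n + 1) : ℕ) : ℝ) = k - 15 * n - 1 := by
    rw [Nat.cast_sub (by omega)]; push_cast; ring
  have g0 := choose_le_exp (2 * k - (15 * n + 2)) (17 * n) a0 b0
  have g1 := choose_le_exp (k - (6 * n + 1)) (5 * n) a1 b1
  have g2 := choose_le_exp (11 * n) (k - (13 * n + 1)) a2 b2
  have g3 := choose_le_exp (11 * n) (k - (15 * n + 1)) a3 b3
  rw [e0] at g0; rw [e1] at g1; rw [e2] at g2; rw [e3] at g3
  unfold taleTwoA
  push_cast
  refine (prod4_le (by positivity) (by positivity) (by positivity) (by positivity) g0 g1 g2 g3).trans (le_of_eq ?_)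
  rw [← Real.exp_add, ← Real.exp_add, ← Real.exp_add]
  congr 1
  rw [← affine_eq u n k]
  push_cast
  ring

/-! ### The critical abscissa `ustar`: the root of `slopeG` -/

/-- `slopeG` is continuous at every `u ∈ (16, 24)`. -/
theorem slopeG_continuousAt {u : ℝ} (hu : 16 < u) (hu' : u < 24) : ContinuousAt slopeG u := by
  obtain ⟨⟨a0, b0⟩, ⟨a1, b1⟩, ⟨a2, b2⟩, ⟨a3, b3⟩⟩ := slopes_mem hu hu'
  unfold t₀ at a0 b0; unfold t₁ at a1 b1; unfold t₂ at a2 b2; unfold t₃ at a3 b3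
  have h1 : (2 * u - 15) ≠ 0 := (by linarith : (0:ℝ) < 2 * u - 15).ne'
  have h2 : u - 6 ≠ 0 := (by linarith : (0:ℝ) < u - 6).ne'
  have h3 : 1 - 17 / (2 * u - 15) ≠ 0 := (by linarith : (0:ℝ) < 1 - 17 / (2 * u - 15)).ne'
  have h4 : 1 - 5 / (u - 6) ≠ 0 := (by linarith : (0:ℝ) < 1 - 5 / (u - 6)).ne'
  have h5 : (u - 13) / 11 ≠ 0 := a2.ne'
  have h6 : 1 - (u - 13) / 11 ≠ 0 := (by linarith : (0:ℝ) < 1 - (u - 13) / 11).ne'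
  have h7 : (u - 15) / 11 ≠ 0 := a3.ne'
  have h8 : 1 - (u - 15) / 11 ≠ 0 := (by linarith : (0:ℝ) < 1 - (u - 15) / 11).ne'
  unfold slopeG t₀ t₁ t₂ t₃
  fun_prop (disch := assumption)

/-- `slopeG 17 > 0` (all four tangent blocks still increasing). -/
theorem slopeG_left_pos : 0 < slopeG 17 := by
  have h1 : Real.log (2 / 19) < 0 := Real.log_neg (by norm_num) (by norm_num)
  have h2 : Real.log (6 / 11) < 0 := Real.log_neg (by norm_num) (by norm_num)
  have h3 : Real.log (4 / 11) < Real.log (7 / 11) := Real.log_lt_log (by norm_num) (by norm_num)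
  have h4 : Real.log (2 / 11) < Real.log (9 / 11) := Real.log_lt_log (by norm_num) (by norm_num)
  have e : slopeG 17 = -2 * Real.log (2 / 19) - Real.log (6 / 11) - Real.log (4 / 11) + Real.log (7 / 11) -
      Real.log (2 / 11) + Real.log (9 / 11) := by
    unfold slopeG t₀ t₁ t₂ t₃; norm_num
  rw [e]; linarith

/-- `slopeG (239/10) < 0` (the block `C(11n, k−13n−1)` is nearly exhausted: `log(1 − t₂) = −log 110 ≤ −6 log 2`). -/
theorem slopeG_right_neg : slopeG (239 / 10) < 0 := by
  have e : slopeG (239 / 10) = -2 * Real.log (79 / 164) - Real.log (129 / 179) - Real.log (109 / 110) +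
      Real.log (1 / 110) - Real.log (89 / 110) + Real.log (21 / 110) := by
    unfold slopeG t₀ t₁ t₂ t₃; norm_num
  have h1 := Real.one_sub_inv_le_log_of_pos (by norm_num : (0:ℝ) < 79 / 164)
  have h2 := Real.one_sub_inv_le_log_of_pos (by norm_num : (0:ℝ) < 129 / 179)
  have h3 := Real.one_sub_inv_le_log_of_pos (by norm_num : (0:ℝ) < 109 / 110)
  have h5 := Real.one_sub_inv_le_log_of_pos (by norm_num : (0:ℝ) < 89 / 110)
  have h6 : Real.log (21 / 110) < 0 := Real.log_neg (by norm_num) (by norm_num)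
  have h4 : Real.log (1 / 110) ≤ -(6 * Real.log 2) := by
    rw [one_div, Real.log_inv, neg_le_neg_iff]
    have h64 : Real.log 64 ≤ Real.log 110 := Real.log_le_log (by norm_num) (by norm_num)
    have : Real.log 64 = 6 * Real.log 2 := by
      rw [show (64:ℝ) = 2 ^ 6 by norm_num, Real.log_pow]; norm_num
    linarith
  have h7 := Real.log_two_gt_d9
  rw [e]; norm_num at h1 h2 h3 h5 ⊢; nlinarith [h1, h2, h3, h4, h5, h6, h7]

/-- **IVT**: `slopeG` has a zero in `[17, 23.9]`. -/
theorem exists_root : ∃ u ∈ Set.Icc (17:ℝ) (239 / 10), slopeG u = 0 := by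
  have hcont : ContinuousOn slopeG (Set.Icc (17:ℝ) (239 / 10)) := fun u hu =>
    (slopeG_continuousAt (by linarith [hu.1]) (by linarith [hu.2])).continuousWithinAt
  have h := intermediate_value_Icc' (by norm_num : (17:ℝ) ≤ 239 / 10) hcont
  have h0 : (0:ℝ) ∈ Set.Icc (slopeG (239 / 10)) (slopeG 17) := ⟨slopeG_right_neg.le, slopeG_left_pos.le⟩
  obtain ⟨u, hu, hu0⟩ := h h0
  exact ⟨u, hu, hu0⟩

/-- The critical abscissa `u* ∈ [17, 23.9]` with `G(u*) = 0` (numerically `u* = 22.0613586…`, the relevant root of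
`(2u−15)²(u−6)(24−u)(26−u) = (2u−32)²(u−11)(u−13)(u−15)`). -/
def ustar : ℝ := exists_root.choose

/-- The defining property of `ustar`: it lies in `[17, 23.9]` and `slopeG ustar = 0`. -/
theorem ustar_spec : ustar ∈ Set.Icc (17:ℝ) (239 / 10) ∧ slopeG ustar = 0 := exists_root.choose_spec

/-- `ustar` lies in the open window `(16, 24)` where all four slopes are in `(0, 1)`. -/
theorem ustar_bounds : 16 < ustar ∧ ustar < 24 :=
  ⟨by linarith [ustar_spec.1.1], by linarith [ustar_spec.1.2]⟩

/-- **The coefficient rate** `C₁* = Λ(u*)`: the height of the horizontal tangent plane of the max-term entropy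
(numerically `42.03361581…`; the enclosure is not proved in this file). -/
def C₁star : ℝ := rateΛ ustar

/-- The bounded penalty constant of the reverse-Chernoff step at `k_n = ⌊u* n⌋`. -/
def penP : ℝ :=
  16 / (t₀ ustar * (1 - t₀ ustar)) + 1 / (t₁ ustar * (1 - t₁ ustar)) + 4 / (t₂ ustar * (1 - t₂ ustar)) +
    4 / (t₃ ustar * (1 - t₃ ustar))

/-! ### Upper bound for `qhat` -/

/-- **Upper half**: `qhat n ≤ (11n+1)·exp(n·C₁* + K₀(u*))` for every `n`. -/
theorem qhat_le (n : ℕ) : (qhat n : ℝ) ≤ (11 * n + 1) * Real.exp (n * C₁star + constK ustar) := by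
  obtain ⟨hu1, hu2⟩ := ustar_bounds
  have hG := ustar_spec.2
  have hc : (Ico (15 * n + 1) (26 * n + 2)).card = 11 * n + 1 := by simp; omega
  unfold qhat
  push_cast
  calc ∑ k ∈ Ico (15 * n + 1) (26 * n + 2), (taleTwoA n k : ℝ)
      ≤ ∑ k ∈ Ico (15 * n + 1) (26 * n + 2), Real.exp (n * C₁star + constK ustar) := by
        apply Finset.sum_le_sum
        intro k hk
        have hk1 : 15 * n + 1 ≤ k := (Finset.mem_Ico.mp hk).1
        have h := taleTwoA_le_exp n k hk1 hu1 hu2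
        rw [hG, mul_zero, add_zero] at h
        exact h
    _ = (11 * n + 1) * Real.exp (n * C₁star + constK ustar) := by
        rw [Finset.sum_const, hc, nsmul_eq_mul]; push_cast; ring

end Summit.KontsevichZagierPeriods.Zeta5Search.TwoTaleP15Growth

end
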